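import Mathlib
import HarnessLib
import Summits.Ventures.LatticeQCDFlow.Exactness.IMHKernel

/-!
# LatticeQCDFlow / Exactness — LEARNING ON THE JOB, XI: ADAPTIVE REWEIGHTING MAY TRAIN ON ITS OWN HISTORY — the importance-sampling
# estimator with the CURRENT flow's weight is unbiased draw by draw, whatever rule produced the current flow from the past draws

HONEST FRAMING: exact (Metropolis-corrected) sampling algorithms for lattice gauge theory;
figures of merit are autocorrelation/cost numbers at stated couplings and volumes; no
continuum-physics claim.

Venture `LatticeQCDFlow` (cell pub-lqcd), topic `Exactness`, FANOUT row 30 (lean-1 GEN-44, theme LEARNING ON THE JOB).  NEW WORK of the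
cell over Mathlib (`Measure.bind`, `lintegral_withDensity_eq_lintegral_mul`); no definition is introduced, nothing is cited as a fact.  The
contrast with the rest of the chapter: the adaptive MARKOV CHAIN may not read its own past without bias (`SelfTunedFlowChoiceBias`,
`LaggedAdaptationDoeblin`), because the current configuration carries the dependence into the next step; the adaptive IMPORTANCE SAMPLER
draws afresh from the current flow, so conditionally on the parameters the draw is exact and the past only chose WHICH exact identity is
used.  Printed counterparts NAMED ONLY: adaptive importance sampling ∕ population Monte Carlo (Cappé–Guillin–Marin–Robert 2004; the
martingale argument), neural importance sampling for lattice field theory (Nicoli et al. 2020).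

## Setting
Parameter space `H`; flows `q : Kernel H Ω` (Markov) with UNNORMALISED-OR-NOT weights `w(h, ·) ≥ 0` measurable such that
`w(h, ·)·q(h) = π` for every `h` (each flow paired with its own weight; `π` the common target measure).  The adaptation rule is ANY Markov
kernel `η : Kernel A H` from a space `A` of pasts (all previous draws, weights, gradients, losses) to parameters; the past has ANY law `m`.

## Results (no `sorry`)
* §1 **`reweight_lintegral_eq`** — one draw: `∫ w(h, y) g(y) q(h)(dy) = ∫ g dπ` for every `h` and measurable `g ≥ 0`.
* §2 **`adaptiveReweight_lintegral_eq`** — for every probability law `ρ_H` of the parameters, `∫∫ w(h, y)g(y) q(h)(dy) ρ_H(dh) = ∫ g dπ`: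
  the reweighted draw is unbiased whatever produced the parameters.  **`adaptiveReweight_past_lintegral_eq`** — with the past explicit:
  `∫∫∫ w(h, y)g(y) q(h)(dy) η(a)(dh) m(da) = m(A)·∫ g dπ` for every law `m` of the past and every adaptation rule `η` reading it — training
  the flow on all previous draws and their weights does not bias the next reweighted draw (hence, summing, the running reweighted average).
* §3 `adaptiveReweight_apply_eq` — the same set-wise: `∫∫ 1_B(y) w(h, y) q(h)(dy) ρ_H(dh) = π(B)`; `adaptiveReweight_sum_lintegral_eq` —
  the running sum of `N` reweighted draws, each from parameters with its own arbitrary law, has mean `N·∫ g dπ`;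
  §4 `adaptiveReweight_ofReal_lintegral_eq` — the real-weight (flow density ratio) reading; `measurable_reweight_lintegral` — bookkeeping.
NOT here (and false in general): unbiasedness of SELF-NORMALISED adaptive estimates, and anything about the adaptive Markov chain.
-/

namespace Summit.Ventures.LatticeQCDFlow.Exactness

open MeasureTheory ProbabilityTheory
open scoped _root_.ENNReal

variable {Ω H : Type*} [MeasurableSpace Ω] [MeasurableSpace H] {π : Measure Ω} (q : Kernel H Ω) {w : H → Ω → ℝ≥0∞}

/-! ## §1 One reweighted draw from a frozen flow -/

/-- **ONE DRAW**: `∫ w(h, y)g(y) q(h)(dy) = ∫ g dπ` when `w(h, ·)·q(h) = π`. [ours] -/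
theorem reweight_lintegral_eq (hw : ∀ h, Measurable (w h)) (hπ : ∀ h, (q h).withDensity (w h) = π) (h : H) {g : Ω → ℝ≥0∞}
    (hg : Measurable g) : ∫⁻ y, w h y * g y ∂(q h) = ∫⁻ y, g y ∂π := by
  rw [← hπ h, lintegral_withDensity_eq_lintegral_mul _ (hw h) hg]
  rfl

/-! ## §2 The parameters may come from anywhere — in particular from the past draws -/

/-- Joint measurability of the reweighted integrand's section integral. [ours, bookkeeping] -/
theorem measurable_reweight_lintegral [IsSFiniteKernel q] (hw : Measurable (Function.uncurry w)) {g : Ω → ℝ≥0∞} (hg : Measurable g) :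
    Measurable fun h => ∫⁻ y, w h y * g y ∂(q h) :=
  (hw.mul (hg.comp measurable_snd)).lintegral_kernel_prod_right

/-- **ADAPTIVE REWEIGHTING IS UNBIASED FOR EVERY LAW OF THE PARAMETERS**: `∫∫ w(h, y)g(y) q(h)(dy) ρ_H(dh) = ∫ g dπ` for every probability
`ρ_H` on `H`. [ours] -/
theorem adaptiveReweight_lintegral_eq (hw : Measurable (Function.uncurry w)) (hπ : ∀ h, (q h).withDensity (w h) = π)
    (ρH : Measure H) [IsProbabilityMeasure ρH] {g : Ω → ℝ≥0∞} (hg : Measurable g) :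
    ∫⁻ h, ∫⁻ y, w h y * g y ∂(q h) ∂ρH = ∫⁻ y, g y ∂π := by
  have hw' : ∀ h, Measurable (w h) := fun h => hw.comp measurable_prodMk_left
  simp_rw [reweight_lintegral_eq q hw' hπ _ hg]
  rw [lintegral_const, measure_univ, mul_one]

/-- **… WITH THE PAST EXPLICIT**: for every law `m` of the past and every adaptation rule `η : Kernel A H` reading it,
`∫∫∫ w(h, y)g(y) q(h)(dy) η(a)(dh) m(da) = m(A)·∫ g dπ` — the rule that maps previous draws, weights and losses to the next flow is
arbitrary. [ours] -/
theorem adaptiveReweight_past_lintegral_eq {A : Type*} [MeasurableSpace A] (hw : Measurable (Function.uncurry w))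
    (hπ : ∀ h, (q h).withDensity (w h) = π) (m : Measure A) (η : Kernel A H) [IsMarkovKernel η] {g : Ω → ℝ≥0∞} (hg : Measurable g) :
    ∫⁻ a, ∫⁻ h, ∫⁻ y, w h y * g y ∂(q h) ∂(η a) ∂m = m Set.univ * ∫⁻ y, g y ∂π := by
  simp_rw [adaptiveReweight_lintegral_eq q hw hπ (η _) hg]
  rw [lintegral_const, mul_comm]

/-- **THE RUNNING SUM**: `N` reweighted draws, the `t`-th from parameters with ANY law `ρ_t` (functions of everything before): the expected
sum is `N·∫ g dπ` — linearity; the dependence between the terms is irrelevant to the mean. [ours] -/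
theorem adaptiveReweight_sum_lintegral_eq (hw : Measurable (Function.uncurry w)) (hπ : ∀ h, (q h).withDensity (w h) = π) {N : ℕ}
    (ρ : Fin N → Measure H) [∀ t, IsProbabilityMeasure (ρ t)] {g : Ω → ℝ≥0∞} (hg : Measurable g) :
    ∑ t, ∫⁻ h, ∫⁻ y, w h y * g y ∂(q h) ∂(ρ t) = N * ∫⁻ y, g y ∂π := by
  simp_rw [adaptiveReweight_lintegral_eq q hw hπ (ρ _) hg]
  rw [Finset.sum_const, Finset.card_univ, Fintype.card_fin, nsmul_eq_mul]

/-! ## §3 As a measure identity -/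

/-- **THE REWEIGHTED PAIR LAW PROJECTS TO `π`**: `∫∫ 1_B(y) w(h, y) q(h)(dy) ρ_H(dh) = π(B)`. [ours] -/
theorem adaptiveReweight_apply_eq (hw : Measurable (Function.uncurry w)) (hπ : ∀ h, (q h).withDensity (w h) = π)
    (ρH : Measure H) [IsProbabilityMeasure ρH] {B : Set Ω} (hB : MeasurableSet B) :
    ∫⁻ h, ∫⁻ y in B, w h y ∂(q h) ∂ρH = π B := by
  have h1 : ∀ h, ∫⁻ y in B, w h y ∂(q h) = ∫⁻ y, w h y * B.indicator 1 y ∂(q h) := fun h => by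
    rw [← lintegral_indicator hB]
    refine lintegral_congr fun y => ?_
    by_cases hy : y ∈ B
    · rw [Set.indicator_of_mem hy, Set.indicator_of_mem hy, Pi.one_apply, mul_one]
    · rw [Set.indicator_of_notMem hy, Set.indicator_of_notMem hy, mul_zero]
  simp_rw [h1]
  rw [adaptiveReweight_lintegral_eq q hw hπ ρH (measurable_one.indicator hB), lintegral_indicator_one hB]

/-! ## §4 The flow reading: importance weights of a normalising flow -/

/-- **FOR FLOWS**: with real weights `0 ≤ w̃(h, ·)` (the ratio `p/g_h` of the target density to the flow density, `ofReal`-coerced) the same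
identity reads `E[w̃(h, Y)g(Y)] = ∫ g dπ` for `Y ∼ q(h)` and every law of `h`. [ours] -/
theorem adaptiveReweight_ofReal_lintegral_eq {wr : H → Ω → ℝ} (hwr : Measurable (Function.uncurry wr))
    (hπ : ∀ h, ((q h).withDensity fun y => ENNReal.ofReal (wr h y)) = π) (ρH : Measure H) [IsProbabilityMeasure ρH]
    {g : Ω → ℝ≥0∞} (hg : Measurable g) : ∫⁻ h, ∫⁻ y, ENNReal.ofReal (wr h y) * g y ∂(q h) ∂ρH = ∫⁻ y, g y ∂π :=
  adaptiveReweight_lintegral_eq q (w := fun h y => ENNReal.ofReal (wr h y)) hwr.ennreal_ofReal hπ ρH hg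

end Summit.Ventures.LatticeQCDFlow.Exactness
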